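import Literature.Probability.LatticeModels.VillainDisorderedModel
import HarnessLib

/-!
# The Nishimori gauge identity for the Villain model with quenched bond phases

C. Garban, T. Spencer, *Continuous symmetry breaking along the Nishimori line*, J. Math. Phys.
**63** (2022) 093302 = arXiv:2109.01617, Lemma 2.1 (`h = 0`) — for the VILLAIN interaction
(Remark 10 of the source: "the proof extends verbatim to the Villain interaction").  With the
vocabulary of `VillainDisorderedModel` (Villain weight `∏_a v_K(arg Y_a(θ,u))`, Nishimori disorder
`∏_a v_K(arg u_a)/Z_K du`, averaged quenched expectation `𝔼_K`), this file PROVES: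

* the elementary calculus of the disorder average `villainDisorderAvg` (linearity, monotonicity,
  triangle inequality, Jensen);
* `villainDisorderAvg_prod` — independence of the phases (product formula);
* `BondSystem.villainDisorderAvg_villainCExpect_bondVar` — **Lemma 2.1**:
  `𝔼_K[⟨F(Y)⟩_{u,K}] = 𝔼_K[F(u)]` for every continuous `F`, by the printed gauge argument
  (`θ ↦ θφ⁻¹`, `u ↦ u·Y(φ,1)`, average over `φ`, cancellation of `Z_u`, translation
  `u ↦ u·Y(θ,1)⁻¹`), transcribed from the tree's XY proof `NishimoriGaugeIdentity` with
  `e^{β Re ·}` replaced by `v_K ∘ arg`.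

## References

* C. Garban, T. Spencer, J. Math. Phys. 63 (2022) 093302, arXiv:2109.01617: Def. 1–2, Lemma 2.1
  with its proof (2.1)–(2.4), Remark 10. [GarbanSpencer2022]
-/

noncomputable section

namespace Literature.Probability.LatticeModels

open MeasureTheory Finset TopologicalSpace
open scoped BigOperators ComplexConjugate
open Literature.MathematicalPhysics.QuantumFieldTheory

variable {ι : Type*} [Fintype ι]

/-! ### Elementary calculus of the Villain disorder average -/

section Calculus

variable {E : Type*} [NormedAddCommGroup E] [NormedSpace ℝ E]

/-- `𝔼_K[1] = 1` (`K > 0`). [folklore] -/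
theorem villainDisorderAvg_const_one {K : ℝ} (hK : 0 < K) :
    villainDisorderAvg (ι := ι) K (fun _ => (1 : ℝ)) = 1 := by
  simp only [villainDisorderAvg, smul_eq_mul, mul_one, integral_villainDisorderDensity hK]

/-- Monotonicity of the disorder average for continuous real functionals (`K > 0`). [folklore] -/
theorem villainDisorderAvg_mono {K : ℝ} (hK : 0 < K) {Φ Ψ : (ι → Circle) → ℝ} (hΦ : Continuous Φ)
    (hΨ : Continuous Ψ) (h : ∀ u, Φ u ≤ Ψ u) : villainDisorderAvg K Φ ≤ villainDisorderAvg K Ψ := by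
  unfold villainDisorderAvg
  refine integral_mono
    (integrable_torusHaar_of_continuous ((continuous_villainDisorderDensity hK).smul hΦ))
    (integrable_torusHaar_of_continuous ((continuous_villainDisorderDensity hK).smul hΨ)) fun u => ?_
  exact smul_le_smul_of_nonneg_left (h u) (villainDisorderDensity_pos hK u).le

/-- The disorder average of a constant (`K > 0`). [folklore] -/
theorem villainDisorderAvg_const [CompleteSpace E] {K : ℝ} (hK : 0 < K) (c : E) :
    villainDisorderAvg (ι := ι) K (fun _ => c) = c := by
  unfold villainDisorderAvg
  rw [integral_smul_const, integral_villainDisorderDensity hK, one_smul]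

/-- A pointwise bound `Φ ≤ c` gives `𝔼_K[Φ] ≤ c` (`K > 0`). [folklore] -/
theorem villainDisorderAvg_le_const {K : ℝ} (hK : 0 < K) {Φ : (ι → Circle) → ℝ} (hΦ : Continuous Φ)
    {c : ℝ} (h : ∀ u, Φ u ≤ c) : villainDisorderAvg K Φ ≤ c := by
  have h1 := villainDisorderAvg_mono hK hΦ continuous_const h
  rwa [villainDisorderAvg_const hK] at h1

/-- Integrability of `D • Φ` for continuous `Φ` (`K > 0`). [folklore] -/
theorem integrable_villainDisorderDensity_smul {K : ℝ} (hK : 0 < K) {Φ : (ι → Circle) → E}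
    (hΦ : Continuous Φ) : Integrable (fun u => villainDisorderDensity K u • Φ u) (torusHaar ι) :=
  integrable_torusHaar_of_continuous ((continuous_villainDisorderDensity hK).smul hΦ)

/-- Additivity of the disorder average (continuous functionals, `K > 0`). [folklore] -/
theorem villainDisorderAvg_add {K : ℝ} (hK : 0 < K) {Φ Ψ : (ι → Circle) → E} (hΦ : Continuous Φ)
    (hΨ : Continuous Ψ) :
    villainDisorderAvg K (fun u => Φ u + Ψ u) = villainDisorderAvg K Φ + villainDisorderAvg K Ψ := by
  unfold villainDisorderAvg
  simp_rw [smul_add]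
  exact integral_add (integrable_villainDisorderDensity_smul hK hΦ)
    (integrable_villainDisorderDensity_smul hK hΨ)

/-- The disorder average of a difference (continuous functionals, `K > 0`). [folklore] -/
theorem villainDisorderAvg_sub {K : ℝ} (hK : 0 < K) {Φ Ψ : (ι → Circle) → E} (hΦ : Continuous Φ)
    (hΨ : Continuous Ψ) :
    villainDisorderAvg K (fun u => Φ u - Ψ u) = villainDisorderAvg K Φ - villainDisorderAvg K Ψ := by
  unfold villainDisorderAvg
  simp_rw [smul_sub]
  exact integral_sub (integrable_villainDisorderDensity_smul hK hΦ)
    (integrable_villainDisorderDensity_smul hK hΨ)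

/-- The disorder average of a finite sum (continuous functionals, `K > 0`). [folklore] -/
theorem villainDisorderAvg_finset_sum {K : ℝ} (hK : 0 < K) {α : Type*} (s : Finset α)
    {Φ : α → (ι → Circle) → E} (hΦ : ∀ i ∈ s, Continuous (Φ i)) :
    villainDisorderAvg K (fun u => ∑ i ∈ s, Φ i u) = ∑ i ∈ s, villainDisorderAvg K (Φ i) := by
  unfold villainDisorderAvg
  simp_rw [Finset.smul_sum]
  exact integral_finsetSum s fun i hi => integrable_villainDisorderDensity_smul hK (hΦ i hi)

/-- Complex constants factor out of the disorder average. [folklore] -/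
theorem villainDisorderAvg_const_mul (K : ℝ) (c : ℂ) (Φ : (ι → Circle) → ℂ) :
    villainDisorderAvg K (fun u => c * Φ u) = c * villainDisorderAvg K Φ := by
  unfold villainDisorderAvg
  rw [← integral_const_mul]
  refine integral_congr_ae (ae_of_all _ fun u => ?_)
  simp only [Complex.real_smul]
  ring

/-- Real constants factor out of the disorder average. [folklore] -/
theorem villainDisorderAvg_const_mul_real (K : ℝ) (c : ℝ) (Φ : (ι → Circle) → ℝ) :
    villainDisorderAvg K (fun u => c * Φ u) = c * villainDisorderAvg K Φ := by
  unfold villainDisorderAvg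
  rw [← integral_const_mul]
  refine integral_congr_ae (ae_of_all _ fun u => ?_)
  simp only [smul_eq_mul]
  ring

/-- The real part of a disorder average is the average of the real part (`K > 0`). [folklore] -/
theorem re_villainDisorderAvg {K : ℝ} (hK : 0 < K) {Φ : (ι → Circle) → ℂ} (hΦ : Continuous Φ) :
    (villainDisorderAvg K Φ).re = villainDisorderAvg K (fun u => (Φ u).re) := by
  unfold villainDisorderAvg
  have h := integral_re (integrable_villainDisorderDensity_smul hK hΦ)
  simp only [RCLike.re_to_complex] at h
  rw [← h]
  refine integral_congr_ae (ae_of_all _ fun u => ?_)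
  simp [Complex.real_smul]

/-- Triangle inequality for the disorder average (`K > 0`). [folklore] -/
theorem norm_villainDisorderAvg_le {K : ℝ} (hK : 0 < K) (Φ : (ι → Circle) → E) :
    ‖villainDisorderAvg K Φ‖ ≤ villainDisorderAvg K (fun u => ‖Φ u‖) := by
  unfold villainDisorderAvg
  refine (norm_integral_le_integral_norm _).trans_eq ?_
  refine integral_congr_ae (ae_of_all _ fun u => ?_)
  dsimp only
  rw [norm_smul, Real.norm_of_nonneg (villainDisorderDensity_pos hK u).le, smul_eq_mul]

/-- The disorder average of a non-negative functional is non-negative (`K > 0`). [folklore] -/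
theorem villainDisorderAvg_nonneg {K : ℝ} (hK : 0 < K) {Φ : (ι → Circle) → ℝ} (h : ∀ u, 0 ≤ Φ u) :
    0 ≤ villainDisorderAvg K Φ := by
  unfold villainDisorderAvg
  exact integral_nonneg fun u => smul_nonneg (villainDisorderDensity_pos hK u).le (h u)

/-- Jensen / Cauchy–Schwarz for the disorder average: `𝔼_K[g]² ≤ 𝔼_K[g²]` (`K > 0`). [folklore] -/
theorem villainDisorderAvg_sq_le {K : ℝ} (hK : 0 < K) {g : (ι → Circle) → ℝ} (hg : Continuous g) :
    villainDisorderAvg K g ^ 2 ≤ villainDisorderAvg K (fun u => g u ^ 2) := by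
  set m := villainDisorderAvg K g with hm
  have h0 : 0 ≤ villainDisorderAvg K (fun u => (g u - m) ^ 2) :=
    villainDisorderAvg_nonneg hK fun u => sq_nonneg _
  have hexp : villainDisorderAvg K (fun u => (g u - m) ^ 2) =
      villainDisorderAvg K (fun u => g u ^ 2) - 2 * m * villainDisorderAvg K g + m ^ 2 := by
    have e : (fun u => (g u - m) ^ 2) = fun u => (g u ^ 2 - (2 * m) * g u) + m ^ 2 := by
      funext u; ring
    rw [e, villainDisorderAvg_add hK (Φ := fun u => g u ^ 2 - (2 * m) * g u) (Ψ := fun _ => m ^ 2)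
        ((hg.pow 2).sub (continuous_const.mul hg)) continuous_const,
      villainDisorderAvg_sub hK (Φ := fun u => g u ^ 2) (Ψ := fun u => (2 * m) * g u)
        (hg.pow 2) (continuous_const.mul hg),
      villainDisorderAvg_const_mul_real K (2 * m) g, villainDisorderAvg_const hK (m ^ 2)]
  rw [hexp, ← hm] at h0
  nlinarith [h0]

end Calculus

/-! ### Independence of the phases: the product formula -/

/-- **Product formula**: `𝔼_K[∏_a g_a(u_a)] = ∏_a ∫ (v_K(arg z)/Z_K) g_a(z) dz`.
[cite: GarbanSpencer2022, Definition 1 (independence over the edges) with Remark 10] -/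
theorem villainDisorderAvg_prod (K : ℝ) (g : ι → Circle → ℂ) :
    villainDisorderAvg K (fun u : ι → Circle => ∏ a, g a (u a)) =
      ∏ a, ∫ z, ((villainKernel K (Complex.arg (z : ℂ)) / villainBondZ K : ℝ) : ℂ) * g a z
        ∂Measure.haarMeasure (⊤ : PositiveCompacts Circle) := by
  unfold villainDisorderAvg villainDisorderDensity torusHaar
  have : ∀ u : ι → Circle,
      (∏ a, villainKernel K (Complex.arg (u a : ℂ)) / villainBondZ K : ℝ) • ∏ a, g a (u a) =
        ∏ a, ((((villainKernel K (Complex.arg (u a : ℂ)) / villainBondZ K : ℝ)) : ℂ) * g a (u a)) :=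
    fun u => by rw [Complex.real_smul, Complex.ofReal_prod, ← Finset.prod_mul_distrib]
  simp_rw [this]
  exact integral_fintype_prod_eq_prod (𝕜 := ℂ)
    (fun (a : ι) (z : Circle) => ((villainKernel K (Complex.arg (z : ℂ)) / villainBondZ K : ℝ) : ℂ) * g a z)

namespace BondSystem

variable {V : Type*} [Fintype V] (G : BondSystem V ι)

/-! ### Lemma 2.1 for the Villain interaction: the gauge identity -/

omit [Fintype V] in
/-- The gauge-shifted Villain disorder density is the Villain weight:
`∏_a v_K(arg(u_a φ̄_{src a} φ_{tgt a}))/Z_K = w_K(u, φ) / Z_K^{|ι|}`.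
[cite: GarbanSpencer2022, proof of Lemma 2.1, (2.3), with Remark 10] -/
theorem villainDisorderDensity_mul_bondVar_one (K : ℝ) (u : ι → Circle) (φ : V → Circle) :
    villainDisorderDensity K (u * G.bondVar 1 φ) =
      G.villainWeight K u φ / villainBondZ K ^ Fintype.card ι := by
  unfold villainDisorderDensity villainWeight
  rw [Finset.prod_div_distrib, Finset.prod_const, Finset.card_univ]
  congr 1
  refine Finset.prod_congr rfl fun a _ => ?_
  simp only [bondVar, Pi.mul_apply, Pi.one_apply, one_mul, mul_assoc]

/-- Averaging the gauge-shifted density over the gauge group gives the partition function: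
`∫ ∏_a (v_K/Z_K)(u_a φ̄_{src a} φ_{tgt a}) dφ = Z_{u,K} / Z_K^{|ι|}`.
[cite: GarbanSpencer2022, proof of Lemma 2.1, (2.3)–(2.4), with Remark 10] -/
theorem integral_villainDisorderDensity_mul_bondVar_one (K : ℝ) (u : ι → Circle) :
    ∫ φ, villainDisorderDensity K (u * G.bondVar 1 φ) ∂torusHaar V =
      G.villainPartitionFn K u / villainBondZ K ^ Fintype.card ι := by
  simp only [villainDisorderDensity_mul_bondVar_one, integral_div, villainPartitionFn]

/-- Gauge invariance of the quenched expectation of bond-variable observables: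
`⟨F(Y)⟩_{u · Y(φ,1)} = ⟨F(Y)⟩_u`. [cite: GarbanSpencer2022, proof of Lemma 2.1, (2.2), with Remark 10] -/
theorem villainCExpect_bondVar_gauge (K : ℝ) (u : ι → Circle) (φ : V → Circle)
    (F : (ι → Circle) → ℂ) :
    G.villainCExpect K (u * G.bondVar 1 φ) (fun θ => F (G.bondVar (u * G.bondVar 1 φ) θ)) =
      G.villainCExpect K u (fun θ => F (G.bondVar u θ)) := by
  rw [villainCExpect_mul_bondVar_one]
  simp only [bondVar_mul_bondVar_one, inv_mul_cancel_right]

/-- **Garban–Spencer 2022, Lemma 2.1 (`h = 0`) for the Villain interaction.** On every finite bond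
system, for `K > 0` and every continuous `F : U(1)^ι → ℂ`,
`𝔼_K[⟨F((u_a θ̄_{src a} θ_{tgt a})_a)⟩_{u,K}] = 𝔼_K[F(u)]`: under the averaged quenched measure
of the Villain model disordered along its Nishimori line, the bond variables are i.i.d. with the
disorder's own law `v_K(arg u) du/Z_K`. [cite: GarbanSpencer2022, Lemma 2.1 with Remark 10] -/
theorem villainDisorderAvg_villainCExpect_bondVar {K : ℝ} (hK : 0 < K) {F : (ι → Circle) → ℂ}
    (hF : Continuous F) :
    villainDisorderAvg K (fun u => G.villainCExpect K u (fun θ => F (G.bondVar u θ))) =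
      villainDisorderAvg K F := by
  -- notation
  set Ex : (ι → Circle) → ℂ := fun u => G.villainCExpect K u (fun θ => F (G.bondVar u θ)) with hEx
  have hFY : Continuous (Function.uncurry fun (u : ι → Circle) (θ : V → Circle) => F (G.bondVar u θ)) :=
    hF.comp (continuous_pi fun a => G.continuous_bondVar_uncurry a)
  have hExc : Continuous Ex := G.continuous_villainCExpect hK hFY
  have hD := continuous_villainDisorderDensity (ι := ι) hK
  have hZρ : (0 : ℝ) < villainBondZ K ^ Fintype.card ι := pow_pos (villainBondZ_pos hK) _
  have hZρC : ((villainBondZ K ^ Fintype.card ι : ℝ) : ℂ) ≠ 0 := by exact_mod_cast hZρ.ne'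
  have hZρ1 : (villainBondZ K : ℂ) ≠ 0 := by exact_mod_cast (villainBondZ_pos hK).ne'
  -- Step 1: for every gauge `φ`, move the density
  have step1 : ∀ φ : V → Circle, villainDisorderAvg K Ex =
      ∫ u, (villainDisorderDensity K (u * G.bondVar 1 φ) : ℂ) * Ex u ∂torusHaar ι := by
    intro φ
    unfold villainDisorderAvg
    rw [← integral_torusHaar_mul_right (fun u => villainDisorderDensity K u • Ex u) (G.bondVar 1 φ)]
    refine integral_congr_ae (ae_of_all _ fun u => ?_)
    simp only [Complex.real_smul, hEx]
    rw [villainCExpect_bondVar_gauge]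
  -- Step 2: average Step 1 over `φ` and swap the integrals
  have step2 : villainDisorderAvg K Ex =
      ∫ u, (∫ φ, (villainDisorderDensity K (u * G.bondVar 1 φ) : ℂ) ∂torusHaar V) * Ex u ∂torusHaar ι := by
    have hc : Continuous (Function.uncurry fun (φ : V → Circle) (u : ι → Circle) =>
        (villainDisorderDensity K (u * G.bondVar 1 φ) : ℂ) * Ex u) := by
      refine (Complex.continuous_ofReal.comp (hD.comp ?_)).mul (hExc.comp continuous_snd)
      exact continuous_snd.mul (continuous_pi fun a =>
        (G.continuous_bondVar_uncurry a).comp (continuous_const.prodMk continuous_fst))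
    calc villainDisorderAvg K Ex = ∫ _φ : V → Circle, villainDisorderAvg K Ex ∂torusHaar V := by
          simp only [integral_const, probReal_univ, one_smul]
      _ = ∫ φ, ∫ u, (villainDisorderDensity K (u * G.bondVar 1 φ) : ℂ) * Ex u ∂torusHaar ι ∂torusHaar V :=
          integral_congr_ae (ae_of_all _ fun φ => step1 φ)
      _ = ∫ u, ∫ φ, (villainDisorderDensity K (u * G.bondVar 1 φ) : ℂ) * Ex u ∂torusHaar V ∂torusHaar ι :=
          integral_integral_swap
            (integrable_of_continuous_of_isFiniteMeasure ((torusHaar V).prod (torusHaar ι)) hc)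
      _ = _ := by
          refine integral_congr_ae (ae_of_all _ fun u => ?_)
          exact integral_mul_const _ _
  -- Step 3: the `φ`-average of the shifted density is `Z_u / Z_K^{|ι|}`, which cancels `Z_u`
  have step3 : villainDisorderAvg K Ex = (∫ u, ∫ θ, F (G.bondVar u θ) * G.villainWeight K u θ ∂torusHaar V
      ∂torusHaar ι) / (villainBondZ K ^ Fintype.card ι : ℝ) := by
    rw [step2, eq_div_iff hZρC, ← integral_mul_const]
    refine integral_congr_ae (ae_of_all _ fun u => ?_)
    dsimp only
    have hZuC : (G.villainPartitionFn K u : ℂ) ≠ 0 := by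
      exact_mod_cast (G.villainPartitionFn_pos hK u).ne'
    rw [integral_complex_ofReal, integral_villainDisorderDensity_mul_bondVar_one, hEx]
    dsimp only [villainCExpect]
    push_cast
    field_simp
  -- Step 4: swap, and freeze the bond variables by `u ↦ u · Y(θ,1)⁻¹`
  have step4 : ∫ u, ∫ θ, F (G.bondVar u θ) * G.villainWeight K u θ ∂torusHaar V ∂torusHaar ι =
      ∫ u, F u * (∏ a, villainKernel K (Complex.arg (u a : ℂ)) : ℝ) ∂torusHaar ι := by
    have hc : Continuous (Function.uncurry fun (u : ι → Circle) (θ : V → Circle) =>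
        F (G.bondVar u θ) * (G.villainWeight K u θ : ℂ)) :=
      hFY.mul (Complex.continuous_ofReal.comp (G.continuous_villainWeight_uncurry hK))
    refine (integral_integral_swap
      (integrable_of_continuous_of_isFiniteMeasure ((torusHaar ι).prod (torusHaar V)) hc)).trans ?_
    calc ∫ θ, ∫ u, F (G.bondVar u θ) * (G.villainWeight K u θ : ℂ) ∂torusHaar ι ∂torusHaar V
        = ∫ _θ : V → Circle, ∫ u, F u * (∏ a, villainKernel K (Complex.arg (u a : ℂ)) : ℝ)
            ∂torusHaar ι ∂torusHaar V := by
          refine integral_congr_ae (ae_of_all _ fun θ => ?_)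
          dsimp only
          rw [← integral_torusHaar_mul_right _ (G.bondVar 1 θ)⁻¹]
          refine integral_congr_ae (ae_of_all _ fun u => ?_)
          dsimp only
          unfold villainWeight
          rw [G.bondVar_mul_inv_bondVar_one u θ]
      _ = _ := by simp only [integral_const, probReal_univ, one_smul]
  -- conclusion
  rw [step3, step4]
  unfold villainDisorderAvg villainDisorderDensity
  rw [div_eq_iff hZρC, ← integral_mul_const]
  refine integral_congr_ae (ae_of_all _ fun u => ?_)
  dsimp only
  rw [Complex.real_smul, Finset.prod_div_distrib, Finset.prod_const, Finset.card_univ]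
  push_cast
  field_simp

end BondSystem

end Literature.Probability.LatticeModels
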